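import Summits.ResolutionOfSingularities.ResolutionOfSingularities.Theses.WeightedInvariant

/-!
# `WeightedThesis` — glue: the target derived by name from the route's items (I)

Support lemmas for crux `stmt-ResolutionOfSingularities-0569`
(`Summit.ResolutionOfSingularities.ResolutionOfSingularities.Theses.WeightedInvariant.WeightedThesis`,
the route's rank-0 target: resolution of every reduced separated scheme of finite type over every
perfect field of characteristic `p`), line `datum-glued-split` (lead
prover-line-stmt-ResolutionOfSingularities-0569-0). The gate auto-cruxed the target on 2026-08-16
because no declaration concluded it BY NAME from the route's items ("underived-target":
`DatumToResolution` concludes its unfolded per-prime body). This file records the pure-logic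
derivations:

* `weightedThesis_of_weightedConstruction_of_datumToResolution` —
  `WeightedConstruction → DatumToResolution → WeightedThesis` (application, prime by prime);
* `datumToResolution_of_weightedThesis` — conversely the target gives `DatumToResolution`
  outright (so under `WeightedConstruction` the target IS `DatumToResolution`);
* `resolutionOfSingularities_of_items` — with the shared descent crux, the three items give the
  summit statement (target prime by prime, then descent; the tail of the route's `closes`).

No definition is declared. Part (II) (the derivation from `DatumToEmbedded` through the tree's
projective reduction) rides with the line's stub `stub_projectiveIntegralSuffices`.
-/

noncomputable section

open Summit.ResolutionOfSingularities.ResolutionOfSingularities.Theses.WeightedInvariant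

set_option linter.dupNamespace false

namespace Summit.ResolutionOfSingularities.ResolutionOfSingularities.Theorems.WeightedThesis.Glue

/-- **The target derived by name**: a weighted resolution datum at every prime
(`WeightedConstruction`, crux stmt-0571) and the layer-2 glue "datum ⇒ resolution over perfect
fields" (`DatumToResolution`, support stmt-8974) give `WeightedThesis`, prime by prime, by
application. [folklore] -/
theorem weightedThesis_of_weightedConstruction_of_datumToResolution :
    Summit.ResolutionOfSingularities.ResolutionOfSingularities.Theses.WeightedInvariant.WeightedConstruction →
      Summit.ResolutionOfSingularities.ResolutionOfSingularities.Theses.WeightedInvariant.DatumToResolution →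
        Summit.ResolutionOfSingularities.ResolutionOfSingularities.Theses.WeightedInvariant.WeightedThesis :=
  fun hC hD p hp k _ _ _ X f hsep hlft hqc hred => hD p hp (hC p hp) k X f hsep hlft hqc hred

/-- Conversely the target implies `DatumToResolution` outright (its conclusion does not mention
the datum). [folklore] -/
theorem datumToResolution_of_weightedThesis (hT : WeightedThesis) : DatumToResolution :=
  fun p hp _ k _ _ _ X f hsep hlft hqc hred => hT p hp k X f hsep hlft hqc hred

/-- **The route's items give the summit**: `WeightedConstruction`, `DatumToResolution` and the
shared descent crux `DescentPerfectToAll` imply `ResolutionOfSingularities` — the target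
`WeightedThesis` prime by prime (`weightedThesis_of_weightedConstruction_of_datumToResolution`),
then descent from perfect fields to all fields of characteristic `p`; this is the tail of the
route's deciding theorem `closes` (which, since the judge repair of 2026-08-16, takes
`DatumToEmbedded` instead of `DatumToResolution` and derives the latter inline, so it is no longer
cited here). [folklore] -/
theorem resolutionOfSingularities_of_items (hC : WeightedConstruction) (hD : DatumToResolution)
    (hDesc : DescentPerfectToAll) : _root_.ResolutionOfSingularities :=
  fun p hp => hDesc p hp (weightedThesis_of_weightedConstruction_of_datumToResolution hC hD p hp)

end Summit.ResolutionOfSingularities.ResolutionOfSingularities.Theorems.WeightedThesis.Glue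

end
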